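import Summits.QuantumFields.BalabanUV.T4Continuum.Support.VariationalTaxiTower

/-!
# T⁴ programme, spine node NE2 (U1a), lane P2 — SUPPORT: THE COHERENT TAXI TOWER (U(1)), PART 3a — A NON-FLAT INHABITANT OF THE DATA CLASS:
# the CONSTANT-FLUX phases on a torus (twisted Landau gauge) — plaquettes and straight coarsening (file 1∕2; the tower is file 2∕2)

NE2 formalisation swarm `b2b-balaban-t4-ne2-formalise-*`, leaf 04 GEN 3 (`prover-b2b-balaban-t4-ne2-formalise-leaf-04-g3-0`); register
P2-sup item (O7) «TAXI TOWER END» (owner GO CLAIMS.log l.11188; this unit's INTENT l.11043, part (4)).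

WHY.  PART 1 (`VariationalTaxiTower`, p215258) and PART 2 feed the road owner's repaired END (`…EndRel` p215080) with a COHERENT tower of unit
lattice phases `R′ k` whose only quantitative datum is ONE scale-invariant plaquette bound `(L^k·L)²·a′_k ≤ c`.  Two located findings
(N-ne2p2g11-2 ≡ G-ne2leaf04g2-1) were about binder sets inhabited only by (block-)flat data; this file shows the data class of the taxi tower END
contains data that are NOT flat: on every level the plaquette holonomy in the `(μ₀, μ₁)`-plane is the SAME non-trivial phase.

THE OBJECTS ([folklore], OURS; abelian lattice gauge theory on a finite torus).
 * `fluxR μ₀ μ₁ N₀ u : Tor N → Fin d → ℂ` — the twisted-Landau-gauge phases with flux unit `u`: `R(x, μ₁) = u^{x_{μ₀}}`, `R(x, μ₀) = (ū)^{N₀·x_{μ₁}}`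
   on the last `μ₀`-slice `x_{μ₀} = N₀ − 1` and `1` elsewhere, `R(x, ν) = 1` for the other directions (coordinates read by `ZMod.val`);
 * `uflux q N₀ N₁ = exp(2πi·q/(N₀N₁))`, `|uflux| = 1`, `‖uflux − 1‖ ≤ 2πq/(N₀N₁)`, `uflux^{N₀N₁} = 1`, and `uflux q (L N₀) (L N₁)^{L²} = uflux q N₀ N₁`;
 * `fluxTower L M μ₀ μ₁ q k := fluxR μ₀ μ₁ (L^(k+1)·M μ₀) (uflux q (L^(k+1) M μ₀) (L^(k+1) M μ₁))` on `Tor (fine L (fine (L^k) M))` — the data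
   of PART 2 at every level.
THE THEOREMS.
 * §1 unit-phase algebra (`u·ū = 1`): the three cases of the flux plaquette;
 * §2 `norm_fluxR` (unit), `plaq_swap` (any phases: `plaq x ν μ = conj (plaq x μ ν)`), **`plaq_fluxR_main`** (`plaq x μ₀ μ₁ = u` when `N₀` is the
   `μ₀`-modulus and `u^{N₀N₁} = 1` — interior, last slice, and the corner plaquette where the flux quantisation enters), `plaq_fluxR_eq_one_*`
   (all other index pairs), **`norm_plaq_fluxR_sub_one_le`** (`‖plaq − 1‖ ≤ ‖u − 1‖` for every plaquette);
 * §3 COHERENCE: **`coarseT_fluxR`** (the straight `L`-bond coarsening of the fine flux phases with unit `u′` IS the coarse flux phases with unit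
   `u′^{L²}` — `L` equal factors in direction `μ₁`; in direction `μ₀` only the last fine bond of the last coarse slice is twisted) and
   **`Rtr_fluxR`** (reading through `sites` preserves coordinates);
 * (file 2∕2 `VariationalTaxiTowerFluxTower`: the flux unit `uflux` and THE TOWER `fluxTower` — unit, plaquette class, coherent, NOT flat.)

HONEST FRAMING (T4-DAG p. 1).  A TOY member of the data class (OURS), elementary; nothing printed is a hypothesis; one data `def` (`fluxR`), no `def … : Prop`; no `sorry`; axioms standard.  It asserts nothing about Bałaban's minimisers (no B0, c5), nothing about
node NE3, and by itself no END (PART 2 consumes it); model level U(1); NE2 NOT proved; spine 0/9; rung (B)+1 finite T⁴ — NOT infinite volume, NOT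
mass gap, NOT Clay.  HONEST DEPENDENCY (cell, verbatim): continuum YM on T⁴ ⇐ BetaPertH ∧ nine spine estimates (0/9 proved);
BetaPertH ⇐ (D1) ∧ (D4) ∧ CAP+tail; G-an2-4 gates asym, D1 and NE2/3/4.
-/

noncomputable section

open scoped BigOperators ComplexConjugate
open Finset

namespace Summit.QuantumFields.BalabanUV.T4Continuum.VariationalTaxiTowerFlux

open Literature.MathematicalPhysics.QuantumFieldTheory.Balaban1983to89.B5Prop11Plancherel (Tor fine unitVec)
open Literature.MathematicalPhysics.QuantumFieldTheory.Balaban1983to89.B5Block118 (tstep tstep_zero tstep_succ bpt)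
open Literature.MathematicalPhysics.QuantumFieldTheory.Balaban1983to89.B5Blocks16 (bpt_val)
open Literature.MathematicalPhysics.QuantumFieldTheory.Balaban1983to89.B5Composition116 (sites recast_apply fine_fine)
open Summit.QuantumFields.BalabanUV.T4Continuum.ScalarBlockTrialFunction (bpt_update')
open Summit.QuantumFields.BalabanUV.T4Continuum.VariationalCovariantFederbush (piT)
open Summit.QuantumFields.BalabanUV.T4Continuum.VariationalCovariantUpperBound (mul_conj_of_norm_one)
open Summit.QuantumFields.BalabanUV.T4Continuum.VariationalCovariantTower (Rtr)
open Summit.QuantumFields.BalabanUV.T4Continuum.VariationalTaxiTransport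
open Summit.QuantumFields.BalabanUV.T4Continuum.VariationalTaxiCoarse

variable {d : ℕ}

/-! ## §1 Unit-phase algebra: the three cases of the flux plaquette -/

section UnitAlgebra

variable {u : ℂ} (hu : ‖u‖ = 1)
include hu

/-- interior plaquette: `u^{a+1}·conj(u^a) = u`. [folklore] -/
theorem flux_case_interior (a : ℕ) : u ^ (a + 1) * conj (u ^ a) = u := by
  have h := (mul_conj_of_norm_one hu).1
  rw [map_pow]
  calc u ^ (a + 1) * conj u ^ a = u * (u * conj u) ^ a := by rw [mul_pow]; ring
    _ = u := by rw [h, one_pow, mul_one]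

/-- last-slice plaquette: `(ū)^{(a+1)b}·u^{(a+1)(b+1)}·conj(u^a) = u`. [folklore] -/
theorem flux_case_slice (a b : ℕ) : conj u ^ ((a + 1) * b) * u ^ ((a + 1) * (b + 1)) * conj (u ^ a) = u := by
  have h := (mul_conj_of_norm_one hu).1
  have e : u ^ ((a + 1) * (b + 1)) = u ^ ((a + 1) * b) * u ^ a * u := by
    rw [show (a + 1) * (b + 1) = (a + 1) * b + a + 1 by ring, pow_add, pow_add, pow_one]
  rw [map_pow, e]
  calc conj u ^ ((a + 1) * b) * (u ^ ((a + 1) * b) * u ^ a * u) * conj u ^ a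
      = u * (u * conj u) ^ ((a + 1) * b) * (u * conj u) ^ a := by rw [mul_pow, mul_pow]; ring
    _ = u := by rw [h, one_pow, one_pow, mul_one, mul_one]

/-- corner plaquette, where the flux quantisation `u^{(a+1)(b+1)} = 1` enters: `(ū)^{(a+1)b}·conj(u^a) = u`. [folklore] -/
theorem flux_case_corner (a b : ℕ) (hK : u ^ ((a + 1) * (b + 1)) = 1) : conj u ^ ((a + 1) * b) * conj (u ^ a) = u := by
  have h := (mul_conj_of_norm_one hu).1
  have hv : conj u ^ ((a + 1) * b + a) * conj u = 1 := by
    rw [← pow_succ, show (a + 1) * b + a + 1 = (a + 1) * (b + 1) by ring, ← map_pow, hK, map_one]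
  rw [map_pow, ← pow_add]
  calc conj u ^ ((a + 1) * b + a) = conj u ^ ((a + 1) * b + a) * (u * conj u) := by rw [h, mul_one]
    _ = u * (conj u ^ ((a + 1) * b + a) * conj u) := by ring
    _ = u := by rw [hv, mul_one]

end UnitAlgebra

/-! ## §2 The constant-flux phases on a torus and their plaquettes -/

section Flux

/-- **THE CONSTANT-FLUX PHASES** (twisted Landau gauge) with flux unit `u` in the `(μ₀, μ₁)`-plane: `R(x, μ₁) = u^{x_{μ₀}}`,
`R(x, μ₀) = (ū)^{N₀·x_{μ₁}}` on the slice `x_{μ₀} = N₀ − 1` (else `1`), all other directions `1`. [folklore] -/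
def fluxR (μ₀ μ₁ : Fin d) (N₀ : ℕ) (u : ℂ) {N : Fin d → ℕ} (x : Tor N) (μ : Fin d) : ℂ :=
  if μ = μ₁ then u ^ (x μ₀).val
  else if μ = μ₀ then (if (x μ₀).val + 1 = N₀ then conj u ^ (N₀ * (x μ₁).val) else 1)
  else 1

variable (μ₀ μ₁ : Fin d) (N₀ : ℕ) (u : ℂ) {N : Fin d → ℕ}

/-- the `μ₁`-phases. [folklore] -/
theorem fluxR_one (x : Tor N) : fluxR μ₀ μ₁ N₀ u x μ₁ = u ^ (x μ₀).val := by simp [fluxR]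

/-- the `μ₀`-phases. [folklore] -/
theorem fluxR_zero (hne : μ₀ ≠ μ₁) (x : Tor N) :
    fluxR μ₀ μ₁ N₀ u x μ₀ = if (x μ₀).val + 1 = N₀ then conj u ^ (N₀ * (x μ₁).val) else 1 := by simp [fluxR, hne]

/-- the other directions carry trivial phases. [folklore] -/
theorem fluxR_other {μ : Fin d} (h0 : μ ≠ μ₀) (h1 : μ ≠ μ₁) (x : Tor N) : fluxR μ₀ μ₁ N₀ u x μ = 1 := by simp [fluxR, h0, h1]

/-- the phases depend on the two coordinates `x_{μ₀}`, `x_{μ₁}` only. [folklore] -/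
theorem fluxR_congr {x x' : Tor N} (h0 : x μ₀ = x' μ₀) (h1 : x μ₁ = x' μ₁) (μ : Fin d) :
    fluxR μ₀ μ₁ N₀ u x μ = fluxR μ₀ μ₁ N₀ u x' μ := by simp only [fluxR, h0, h1]

/-- unit flux unit ⟹ unit phases. [folklore] -/
theorem norm_fluxR (hu : ‖u‖ = 1) (x : Tor N) (μ : Fin d) : ‖fluxR μ₀ μ₁ N₀ u x μ‖ = 1 := by
  unfold fluxR
  split_ifs <;> simp [norm_pow, hu]

variable [hN : ∀ ν, NeZero (N ν)]

omit hN in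
/-- stepping in direction `μ` raises the `μ`-coordinate by one … [folklore] -/
theorem add_unitVec_self (x : Tor N) (μ : Fin d) : (x + unitVec N μ) μ = x μ + 1 := by
  simp [unitVec]

omit hN in
/-- … and leaves the others alone. [folklore] -/
theorem add_unitVec_ne (x : Tor N) {μ ν : Fin d} (h : ν ≠ μ) : (x + unitVec N μ) ν = x ν := by
  simp [unitVec, h]

/-- `val (z + 1)` on `ZMod n`, `n ≥ 2`: wraps to `0` exactly on the last residue. [folklore] -/
theorem val_add_one {n : ℕ} [NeZero n] (hn : 2 ≤ n) (z : ZMod n) :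
    (z + 1).val = if z.val + 1 = n then 0 else z.val + 1 := by
  rw [ZMod.val_add, ZMod.val_one_eq_one_mod, Nat.mod_eq_of_lt (by omega : 1 < n)]
  split_ifs with h
  · rw [h, Nat.mod_self]
  · exact Nat.mod_eq_of_lt (by have := z.val_lt; omega)

end Flux

section Plaquettes

variable (L : ℕ) [NeZero L] (N : Fin d → ℕ) [hN : ∀ ν, NeZero (N ν)]
variable (μ₀ μ₁ : Fin d) (u : ℂ)

omit [NeZero L] hN in
/-- transposed plaquettes are conjugate (any phases). [folklore] -/
theorem plaq_swap (R : Tor (fine L N) → Fin d → ℂ) (x : Tor (fine L N)) (μ ν : Fin d) :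
    plaq L N R x ν μ = conj (plaq L N R x μ ν) := by
  simp only [plaq, map_mul, Complex.conj_conj]
  ring

omit [NeZero L] in
/-- a modulus of the fine torus is at least `L`. [folklore] -/
theorem two_le_fine (hL : 2 ≤ L) (μ : Fin d) : 2 ≤ fine L N μ := by
  show 2 ≤ L * N μ
  have := Nat.pos_of_ne_zero (NeZero.ne (N μ))
  nlinarith

/-- **THE FLUX PLAQUETTE**: in the `(μ₀, μ₁)`-plane every plaquette of the constant-flux phases equals the flux unit `u` — `N₀ = ` the
`μ₀`-modulus, `u^{N₀·N₁} = 1` the flux quantisation used at the corner plaquette. [folklore] -/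
theorem plaq_fluxR_main (hL : 2 ≤ L) (hne : μ₀ ≠ μ₁) (hu : ‖u‖ = 1) (hK : u ^ (fine L N μ₀ * fine L N μ₁) = 1)
    (x : Tor (fine L N)) : plaq L N (fluxR μ₀ μ₁ (fine L N μ₀) u) x μ₀ μ₁ = u := by
  have h2₀ := two_le_fine L N hL μ₀
  have h2₁ := two_le_fine L N hL μ₁
  have hne' : μ₁ ≠ μ₀ := fun h => hne h.symm
  -- the four bond phases
  have eA : fluxR μ₀ μ₁ (fine L N μ₀) u (x + unitVec (fine L N) μ₀) μ₁ = u ^ (x μ₀ + 1).val := by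
    rw [fluxR_one, add_unitVec_self]
  have eB : fluxR μ₀ μ₁ (fine L N μ₀) u (x + unitVec (fine L N) μ₁) μ₀
      = if (x μ₀).val + 1 = fine L N μ₀ then conj u ^ (fine L N μ₀ * (x μ₁ + 1).val) else 1 := by
    rw [fluxR_zero μ₀ μ₁ _ u hne, add_unitVec_ne _ hne, add_unitVec_self]
  rw [plaq, eA, eB, fluxR_zero μ₀ μ₁ _ u hne, fluxR_one, val_add_one h2₀, val_add_one h2₁]
  by_cases ha : (x μ₀).val + 1 = fine L N μ₀
  · rw [if_pos ha, if_pos ha, if_pos ha, pow_zero, mul_one]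
    by_cases hb : (x μ₁).val + 1 = fine L N μ₁
    · rw [if_pos hb, mul_zero, pow_zero, map_one, mul_one]
      have key := flux_case_corner hu (x μ₀).val (x μ₁).val (by rw [ha, hb]; exact hK)
      rw [ha] at key
      exact key
    · rw [if_neg hb, map_pow, Complex.conj_conj]
      have key := flux_case_slice hu (x μ₀).val (x μ₁).val
      rw [ha] at key
      exact key
  · rw [if_neg ha, if_neg ha, if_neg ha, one_mul, map_one, mul_one]
    exact flux_case_interior hu (x μ₀).val

omit [NeZero L] hN in
/-- off the `(μ₀, μ₁)`-plane in the first slot the plaquettes are trivial. [folklore] -/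
theorem plaq_fluxR_eq_one_left (N₀ : ℕ) (hu : ‖u‖ = 1) {μ : Fin d} (h0 : μ ≠ μ₀) (h1 : μ ≠ μ₁) (x : Tor (fine L N)) (ν : Fin d) :
    plaq L N (fluxR μ₀ μ₁ N₀ u) x μ ν = 1 := by
  have hc : fluxR μ₀ μ₁ N₀ u (x + unitVec (fine L N) μ) ν = fluxR μ₀ μ₁ N₀ u x ν :=
    fluxR_congr μ₀ μ₁ N₀ u (add_unitVec_ne x (fun h => h0 h.symm)) (add_unitVec_ne x (fun h => h1 h.symm)) ν
  rw [plaq, fluxR_other μ₀ μ₁ N₀ u h0 h1, fluxR_other μ₀ μ₁ N₀ u h0 h1, hc, map_one, one_mul, mul_one]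
  exact (mul_conj_of_norm_one (norm_fluxR μ₀ μ₁ N₀ u hu x ν)).1

omit [NeZero L] hN in
/-- off the `(μ₀, μ₁)`-plane in the second slot the plaquettes are trivial. [folklore] -/
theorem plaq_fluxR_eq_one_right (N₀ : ℕ) (hu : ‖u‖ = 1) (μ : Fin d) {ν : Fin d} (h0 : ν ≠ μ₀) (h1 : ν ≠ μ₁) (x : Tor (fine L N)) :
    plaq L N (fluxR μ₀ μ₁ N₀ u) x μ ν = 1 := by
  rw [plaq_swap, plaq_fluxR_eq_one_left L N μ₀ μ₁ u N₀ hu h0 h1, map_one]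

/-- **THE PLAQUETTE DEFECT OF THE CONSTANT-FLUX PHASES**: `‖plaq − 1‖ ≤ ‖u − 1‖` for every plaquette. [folklore] -/
theorem norm_plaq_fluxR_sub_one_le (hL : 2 ≤ L) (hne : μ₀ ≠ μ₁) (hu : ‖u‖ = 1) (hK : u ^ (fine L N μ₀ * fine L N μ₁) = 1)
    (x : Tor (fine L N)) (μ ν : Fin d) : ‖plaq L N (fluxR μ₀ μ₁ (fine L N μ₀) u) x μ ν - 1‖ ≤ ‖u - 1‖ := by
  have hR1 : ∀ x μ, ‖fluxR μ₀ μ₁ (fine L N μ₀) u (N := fine L N) x μ‖ = 1 := norm_fluxR μ₀ μ₁ _ u hu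
  have h0 : ‖(1 : ℂ) - 1‖ ≤ ‖u - 1‖ := by rw [sub_self, norm_zero]; exact norm_nonneg _
  by_cases hμν : μ = ν
  · rw [hμν, plaq_self L N hR1]; exact h0
  by_cases hμ0 : μ = μ₀
  · rw [hμ0] at hμν ⊢
    by_cases hν1 : ν = μ₁
    · rw [hν1, plaq_fluxR_main L N μ₀ μ₁ u hL hne hu hK]
    · rw [plaq_fluxR_eq_one_right L N μ₀ μ₁ u _ hu μ₀ (fun h => hμν h.symm) hν1]; exact h0
  by_cases hμ1 : μ = μ₁
  · rw [hμ1] at hμν ⊢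
    by_cases hν0 : ν = μ₀
    · rw [hν0, plaq_swap, plaq_fluxR_main L N μ₀ μ₁ u hL hne hu hK,
        show conj u - 1 = conj (u - 1) by rw [map_sub, map_one], Complex.norm_conj]
    · rw [plaq_fluxR_eq_one_right L N μ₀ μ₁ u _ hu μ₁ hν0 (fun h => hμν h.symm)]; exact h0
  · rw [plaq_fluxR_eq_one_left L N μ₀ μ₁ u _ hu hμ0 hμ1]; exact h0

end Plaquettes

/-! ## §3 Coherence: straight coarsening and the `sites` reading of the constant-flux phases -/

section Coherence

variable (L : ℕ) [NeZero L] (N : Fin d → ℕ) [hN : ∀ ν, NeZero (N ν)]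
variable (μ₀ μ₁ : Fin d)

omit [NeZero L] hN in
/-- the straight leg as a product. [folklore] -/
theorem piT_eq_prod (R : Tor (fine L N) → Fin d → ℂ) (p : Tor (fine L N)) (μ : Fin d) (t : ℕ) :
    piT L N R p μ t = ∏ s ∈ Finset.range t, R (p + tstep (fine L N) μ s) μ := by
  induction t with
  | zero => simp [piT]
  | succ t ih => rw [Finset.prod_range_succ, ← ih]; rfl

/-- the coordinates of the `s`-th point on the straight coarse bond from the block corner `L·y`. [folklore] -/
theorem val_corner_add_tstep (y : Tor N) (μ ν : Fin d) {s : ℕ} (hs : s < L) :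
    ((bpt L N y 0 + tstep (fine L N) μ s) ν).val = L * (y ν).val + if ν = μ then s else 0 := by
  have e : bpt L N y 0 + tstep (fine L N) μ s = bpt L N y (Function.update 0 μ ⟨s, hs⟩) := by
    rw [bpt_update' L N y 0 μ ⟨s, hs⟩]
    simp
  rw [e, bpt_val]
  by_cases h : ν = μ
  · subst h; simp
  · simp [h]

omit hN in
/-- the arithmetic of the last slice: for `s < L`, `L·y₀ + s + 1 = L·N₀ ⟺ s + 1 = L ∧ y₀ + 1 = N₀`. [folklore] -/
theorem slice_iff {y₀ N₀ s : ℕ} (hs : s < L) : L * y₀ + s + 1 = L * N₀ ↔ s + 1 = L ∧ y₀ + 1 = N₀ := by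
  have hL : 0 < L := Nat.pos_of_ne_zero (NeZero.ne L)
  constructor
  · intro h
    have h1 : L * N₀ ≤ L * (y₀ + 1) := by rw [← h]; nlinarith
    have h2 : L * y₀ < L * N₀ := by rw [← h]; omega
    have hN : N₀ = y₀ + 1 :=
      le_antisymm (Nat.le_of_mul_le_mul_left h1 hL) (Nat.succ_le_of_lt (Nat.lt_of_mul_lt_mul_left h2))
    subst hN
    constructor
    · nlinarith
    · rfl
  · rintro ⟨h1, h2⟩
    subst h2
    rw [← h1]; ring

/-- **STRAIGHT COARSENING OF THE FLUX PHASES**: the `L`-bond straight transport of the fine constant-flux phases with unit `u′` and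
`μ₀`-parameter `L·N₀` IS the coarse constant-flux phase with unit `u′^{L²}` and parameter `N₀`. [folklore] -/
theorem coarseT_fluxR (hne : μ₀ ≠ μ₁) (N₀ : ℕ) (u' : ℂ) :
    coarseT L N (fluxR μ₀ μ₁ (L * N₀) u') = fluxR μ₀ μ₁ N₀ (u' ^ (L * L)) (N := N) := by
  have hL : 0 < L := Nat.pos_of_ne_zero (NeZero.ne L)
  have hne' : μ₁ ≠ μ₀ := fun h => hne h.symm
  funext y μ
  rw [coarseT, piT_eq_prod]
  by_cases hμ1 : μ = μ₁
  · rw [hμ1, Finset.prod_congr rfl (fun s hs => by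
      rw [fluxR_one, val_corner_add_tstep L N y μ₁ μ₀ (Finset.mem_range.mp hs), if_neg hne, add_zero]),
      Finset.prod_const, Finset.card_range, fluxR_one, ← pow_mul, ← pow_mul]
    congr 1; ring
  · by_cases hμ0 : μ = μ₀
    · rw [hμ0, fluxR_zero μ₀ μ₁ N₀ _ hne, Finset.prod_eq_single (L - 1)]
      · -- the last fine bond of the coarse bond
        rw [fluxR_zero μ₀ μ₁ (L * N₀) u' hne, val_corner_add_tstep L N y μ₀ μ₀ (by omega), if_pos rfl,
          val_corner_add_tstep L N y μ₀ μ₁ (by omega), if_neg hne', add_zero]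
        have hiff := slice_iff L (y₀ := (y μ₀).val) (N₀ := N₀) (s := L - 1) (by omega)
        by_cases hy : (y μ₀).val + 1 = N₀
        · rw [if_pos (hiff.mpr ⟨by omega, hy⟩), if_pos hy, map_pow, ← pow_mul]
          congr 1; ring
        · rw [if_neg (fun h => hy (hiff.mp h).2), if_neg hy]
      · intro s hs hsL
        rw [fluxR_zero μ₀ μ₁ (L * N₀) u' hne, val_corner_add_tstep L N y μ₀ μ₀ (Finset.mem_range.mp hs), if_pos rfl]
        have hiff := slice_iff L (y₀ := (y μ₀).val) (N₀ := N₀) (s := s) (Finset.mem_range.mp hs)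
        rw [if_neg (fun h => hsL (by have := (hiff.mp h).1; omega))]
      · intro h; exact absurd (Finset.mem_range.mpr (by omega)) h
    · rw [fluxR_other μ₀ μ₁ N₀ _ hμ0 hμ1, Finset.prod_eq_one (fun s _ => fluxR_other μ₀ μ₁ (L * N₀) u' hμ0 hμ1 _)]

end Coherence

section Sites

variable (n L : ℕ) [NeZero n] [NeZero L] (M : Fin d → ℕ) [hM : ∀ ν, NeZero (M ν)] (μ₀ μ₁ : Fin d)

omit [NeZero n] [NeZero L] hM in
/-- `sites` preserves coordinates. [folklore] -/
theorem val_sites (x : Tor (fine (n * L) M)) (ν : Fin d) : (sites n L M x ν).val = (x ν).val := by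
  unfold sites
  rw [recast_apply, ZMod.ringEquivCongr_val]

omit [NeZero n] [NeZero L] hM in
/-- **READING THROUGH `sites` PRESERVES THE FLUX PHASES** (they are functions of the coordinates). [folklore] -/
theorem Rtr_fluxR (N₀ : ℕ) (u : ℂ) : Rtr n L M (fluxR μ₀ μ₁ N₀ u) = fluxR μ₀ μ₁ N₀ u (N := fine (n * L) M) := by
  funext x μ
  simp only [Rtr, fluxR, val_sites]

end Sites

end Summit.QuantumFields.BalabanUV.T4Continuum.VariationalTaxiTowerFlux

end
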